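import Summits.HodgeConjecture.HodgeConjecture.Theorems.VHCAbelianSchemesRoadServedFibre
import Summits.HodgeConjecture.HodgeConjecture.Theorems.VHCAbelianSchemesRoadDesignNecessary
import HarnessLib

/-!
# Road b02 (`VHCAbelianSchemesRoad`) — THE SERVED-FIBRE PARTITION AT THE ANCHORS: necessity of a carrier modulo Lefschetz classes; non-vacuity

research route conditional on HC_CM; not a corollary; Q11.4-sentence-2 already refuted in dim ≥ 3.

Door-, degree- and anchor-generic, FACT-FREE; companion of `VHCAbelianSchemesRoadServedFibre` (the partition «anchored carrier ∧ residual ⟹ cell»).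
Both theorems run the CONSTANT PENCIL `pr₂ : X × 𝔸¹ ⟶ 𝔸¹` through an anchor `(X, θ)` (PART Z-c `VHCAbelianSchemesRoadDesignNecessary`: it satisfies
every binder of the cell), with `W := pr₁^*w` for a served rational ALGEBRAIC class `w ∉ Dᵖ(X) ⊗ ℂ` (so the regime-2 hypotheses hold: algebraic at the
origin, Lefschetz nowhere) and the polarising global class `Θ := pr₁^*θ` (rational `(1,1)` on every fibre); the pencil is SERVED at the origin as
soon as the anchor data is TRANSPORTABLE ALONG ISOMORPHISMS (hypothesis `htr` — automatic for every «`X` is isomorphic to …» anchor predicate with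
its served set defined by transport), because the fibre `(X × 𝔸¹)_{s₀}` is only ISOMORPHIC to `X` (slice isomorphism).

* §1 `exists_designModLefschetz_at_anchor_of_under_hasServedFibre` — the conditional cell `LefAtExceptionalRegimeAtUnder 𝒪 n p (HasServedFibre n p 𝔄 𝔖)`
  (the «through-anchor» piece) already DEMANDS, at every anchor `(X ≅` abelian `n`-fold, `θ` rational `(1,1))` and every served rational algebraic
  `w ∉ Dᵖ ⊗ ℂ`, an `𝒪`-datum on SOME COPY `e : X' ≅ X` with `κ_p = e^*(a·w + z)`, `a ≠ 0`, `z` an algebraic Lefschetz class, sides `(q,q)`; variant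
  `…_at_polarisedAnchor_…` reading the hypotheses on `(X, θ)` off an anchor predicate of polarised abelian `n`-folds. So the through-anchor piece is
  SANDWICHED between the anchored carrier statement (`under_hasServedFibre_of_anchoredCarrierAt`) and the same statement modulo the sandwich's slack
  (which copy; side degrees `(q,q)` vs on the `θ`-ray) — the kernel glue of skeleton v3's N5 loses nothing detectable at this resolution.
* §2 `exists_servedPencil_of_anchor` — NON-VACUITY of the partition variable INSIDE the cell's binders: one anchor with a served rational algebraic
  class off `Dᵖ ⊗ ℂ` yields a one-parameter abelian scheme of the cell's shape, a class `W` satisfying the regime-2 hypotheses, AND a served fibre.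
  (The tribunal's «no cosmetic split» check for a through-anchor / residual cut thus reduces to exhibiting ONE such anchor for the typed `(𝔄, 𝔖)`.)

What is NOT claimed: any anchored carrier statement, any residual, any cell, K-SR♭∃, VHC, `HC_AV`, HC; that any particular anchor predicate is
inhabited; `HC_CM` occurs nowhere. References: [cite: Bloch1972Semiregularity, Remark (7.5)] [cite: vanGeemen1994HodgeAV, §2.4 and Thm. 4.11]
[cite: Hartshorne1977, II.3 (p. 89) and II Ex. 4.9] [cite: Markman2025SecantWeil, Thm. 1.4.1] [cite: VoisinHodgeI2002, Thm. 7.10 and §7.1.2].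
-/

noncomputable section

open CategoryTheory CategoryTheory.Limits AlgebraicGeometry Topology MonoidalCategory CartesianMonoidalCategory

-- the cell's namespace repeats the summit name (`Summit.HodgeConjecture.HodgeConjecture…`), as in every `Ring2*` file
set_option linter.dupNamespace false

namespace Summit.HodgeConjecture.HodgeConjecture.Ring2.SemiregularRepresentatives

open Literature.AlgebraicGeometry Literature.AlgebraicGeometry.Motives
open Literature.AlgebraicGeometry.HodgeTheory
open Literature.AlgebraicTopology.SingularHomology
open Literature.Barriers.HodgeConjecture (divisorClassesSpan)
open Summit.Ventures.HSemireg (ObjClass)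

variable {𝒪 : ObjClass} {n p : ℕ}
variable {𝔄 : ∀ X : SchemeOver ℂ, complexBetti X 2 → Prop} {𝔖 : ∀ (X : SchemeOver ℂ), complexBetti X 2 → Set (complexBetti X (2 * p))}

/-! ## §1 Necessity at the anchors: the through-anchor piece already demands a carrier modulo Lefschetz classes on a copy of every anchor -/

/-- **THE CELL UNDER «HAS A SERVED FIBRE» DEMANDS A CARRIER MODULO LEFSCHETZ CLASSES AT EVERY ANCHOR** (door-, degree-, anchor-generic; fact-free).
Let the anchor data be TRANSPORTABLE ALONG ISOMORPHISMS (`htr`: an isomorphism `e : X ≅ X'` carries an anchor `(X, θ)` with served class `w` to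
the anchor `(X', (e⁻¹)^*θ)` with served class `(e⁻¹)^*w` — automatic for every «`X` is isomorphic to …» predicate). Then for every anchor `(X, θ)`
with `X ≅` an abelian `n`-fold and `θ` rational of type `(1,1)`, and every served rational ALGEBRAIC class `w ∉ Dᵖ(X) ⊗ ℂ`, the conditional cell
`LefAtExceptionalRegimeAtUnder 𝒪 n p (HasServedFibre n p 𝔄 𝔖)` yields SOME COPY `e : X' ≅ X` with an `𝒪`-datum `(I ∋ p, κ)` on `X'`,
`κ_p = e^*(a·w + z)`, `a ≠ 0`, `z` an algebraic Lefschetz class of `X`, every `κ_q` of type `(q,q)`: run the conditional cell on the CONSTANT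
pencil `pr₂ : X × 𝔸¹ ⟶ 𝔸¹` with `W := pr₁^*w` (algebraic and non-Lefschetz on every fibre) — it is served at the origin by `Θ := pr₁^*θ` — and
read the datum on the slice `(X × 𝔸¹)_{s₁} ≅ X` (PART Z-c). So the through-anchor piece is SANDWICHED: anchored carrier ⟹ it ⟹ anchored
carrier modulo the slack (which copy; sides `(q,q)` vs on the `θ`-ray). [cite: Bloch1972Semiregularity, Remark (7.5)]
[cite: vanGeemen1994HodgeAV, §2.4 and Thm. 4.11] [cite: Hartshorne1977, II.3 (p. 89) and II Ex. 4.9] [cite: Markman2025SecantWeil, Thm. 1.4.1] -/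
theorem exists_designModLefschetz_at_anchor_of_under_hasServedFibre
    (h : LefAtExceptionalRegimeAtUnder 𝒪 n p (HasServedFibre n p 𝔄 𝔖))
    (htr : ∀ ⦃X X' : SchemeOver ℂ⦄ (e : X ≅ X') (θ : complexBetti X 2) (w : complexBetti X (2 * p)), 𝔄 X θ → w ∈ 𝔖 X θ →
      𝔄 X' (complexBetti.map e.inv 2 θ) ∧ complexBetti.map e.inv (2 * p) w ∈ 𝔖 X' (complexBetti.map e.inv 2 θ))
    (X : SchemeOver ℂ) (hXab : ∃ A : AbelianVariety ℂ, A.dim = n ∧ Nonempty (A.X ≅ X))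
    (θ : complexBetti X 2) (hθQ : IsRationalClass θ) (hθH : IsOfHodgeType n X 2 1 1 θ) (hanc : 𝔄 X θ)
    (w : complexBetti X (2 * p)) (hw𝔖 : w ∈ 𝔖 X θ) (hwQ : IsRationalClass w) (hwalg : w ∈ algebraicClasses X p)
    (hwD : w ∉ divisorClassesSpan X n p) :
    ∃ (X' : SchemeOver ℂ) (e : X' ≅ X) (I : Finset ℕ) (κ : (q : ℕ) → complexBetti X' (2 * q)) (a : ℂ) (z : complexBetti X (2 * p)),
      p ∈ I ∧ 𝒪 n X' I κ ∧ a ≠ 0 ∧ z ∈ algebraicClasses X p ∧ z ∈ divisorClassesSpan X n p ∧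
      κ p = complexBetti.map e.hom (2 * p) (a • w + z) ∧ ∀ q ∈ I, IsOfHodgeType n X' (2 * q) q q (κ q) := by
  obtain ⟨A, hA, ⟨eA⟩⟩ := hXab
  have hAX : IsSmoothProjective n A.X := hA ▸ AbelianVariety.isSmoothProjective_holds (A := A)
  have hX : IsSmoothProjective n X := hAX.of_iso eA
  have hwH : IsOfHodgeType n X (2 * p) p p w := isOfHodgeType_of_mem_algebraicClasses_of_isSmoothProjective hX p hwalg
  -- the base `C = 𝔸¹`
  haveI : IrreducibleSpace (specOver ℂ (MvPolynomial (Fin 1) ℂ)).left := irreducibleSpace_affineLine_left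
  haveI : IsAffine (specOver ℂ (MvPolynomial (Fin 1) ℂ)).left := isAffine_affineLine_left
  obtain ⟨s₀⟩ := nonempty_complexPoints_affineLine
  -- the constant pencil and its binders
  have hf : IsSmoothProjectiveFamily (snd X (specOver ℂ (MvPolynomial (Fin 1) ℂ))) n :=
    isSmoothProjectiveFamily_snd hX _
  have h𝒳 : IsQuasiProjectiveOver (X ⊗ specOver ℂ (MvPolynomial (Fin 1) ℂ)) :=
    isQuasiProjectiveOver_tensor_of_isProjectiveOver hX.isProjectiveOver isQuasiProjectiveOver_affineLine
  have habel : ∀ s : ComplexPoints (specOver ℂ (MvPolynomial (Fin 1) ℂ)),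
      ∃ A' : AbelianVariety ℂ, A'.dim = n ∧ Nonempty (A'.X ≅ fiberOver (snd X (specOver ℂ (MvPolynomial (Fin 1) ℂ))) s) :=
    fun s ↦ ⟨A, hA, ⟨eA ≪≫ sliceFiberIso X s⟩⟩
  -- the class `W := pr₁^* w`, the polarising class `Θ := pr₁^* θ`, and their restrictions
  have hres := fun s : ComplexPoints (specOver ℂ (MvPolynomial (Fin 1) ℂ)) ↦ map_fiberι_map_fst_eq s (2 * p) w
  have hresθ := fun s : ComplexPoints (specOver ℂ (MvPolynomial (Fin 1) ℂ)) ↦ map_fiberι_map_fst_eq s 2 θ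
  have hW : ∀ s : ComplexPoints (specOver ℂ (MvPolynomial (Fin 1) ℂ)),
      IsRationalClass (complexBetti.map (fiberι (snd X _) s) (2 * p) (complexBetti.map (fst X _) (2 * p) w)) ∧
        IsOfHodgeType n (fiberOver (snd X _) s) (2 * p) p p
          (complexBetti.map (fiberι (snd X _) s) (2 * p) (complexBetti.map (fst X _) (2 * p) w)) := by
    intro s
    rw [hres s]
    exact ⟨(isRationalClass_map_iff_of_iso (sliceFiberIso X s).symm).2 hwQ,
      (isOfHodgeType_map_iff_of_iso (sliceFiberIso X s).symm).2 hwH⟩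
  have hWs₀ : complexBetti.map (fiberι (snd X _) s₀) (2 * p) (complexBetti.map (fst X _) (2 * p) w) ∈
      algebraicClasses (fiberOver (snd X (specOver ℂ (MvPolynomial (Fin 1) ℂ))) s₀) p := by
    rw [hres s₀]
    exact (mem_algebraicClasses_map_iff_of_iso (sliceFiberIso X s₀).symm).2 hwalg
  have hexc : ¬ ∀ s : ComplexPoints (specOver ℂ (MvPolynomial (Fin 1) ℂ)),
      complexBetti.map (fiberι (snd X _) s) (2 * p) (complexBetti.map (fst X _) (2 * p) w) ∈
          algebraicClasses (fiberOver (snd X _) s) p ∧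
        complexBetti.map (fiberι (snd X _) s) (2 * p) (complexBetti.map (fst X _) (2 * p) w) ∈
          divisorClassesSpan (fiberOver (snd X _) s) n p := by
    intro hall
    obtain ⟨-, hD⟩ := hall s₀
    apply hwD
    have hback := map_mem_divisorClassesSpan hX (hf.isSmoothProjective s₀) (sliceFiberIso X s₀).hom hD
    rwa [hres s₀, (sliceFiberIso X s₀).complexBetti_map_hom_map_inv] at hback
  -- the constant pencil is SERVED at the origin by `Θ := pr₁^* θ`
  have hserved : HasServedFibre n p 𝔄 𝔖 (snd X (specOver ℂ (MvPolynomial (Fin 1) ℂ))) (complexBetti.map (fst X _) (2 * p) w) := by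
    refine ⟨s₀, complexBetti.map (fst X _) 2 θ, fun s ↦ ?_, fun s ↦ ?_, ?_, ?_⟩
    · rw [hresθ s]
      exact (isRationalClass_map_iff_of_iso (sliceFiberIso X s).symm).2 hθQ
    · rw [hresθ s]
      exact (isOfHodgeType_map_iff_of_iso (sliceFiberIso X s).symm).2 hθH
    · rw [hresθ s₀]
      exact (htr (sliceFiberIso X s₀) θ w hanc hw𝔖).1
    · rw [hresθ s₀, hres s₀]
      exact (htr (sliceFiberIso X s₀) θ w hanc hw𝔖).2
  obtain ⟨s₁, I, κ, V, a, Z, hpI, h𝒪, ha, hZ, hV, hκV, hVH⟩ :=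
    h (snd X _) hf h𝒳 irreducibleSpace_affineLine_left isAffine_affineLine_left smooth_affineLine_hom
      topologicalKrullDim_affineLine_left habel (exists_section_snd A eA _) _ hW s₀ hWs₀ hexc hserved
  refine ⟨fiberOver (snd X _) s₁, (sliceFiberIso X s₁).symm, I, κ, a,
    complexBetti.map (sliceFiberIso X s₁).hom (2 * p) (complexBetti.map (fiberι (snd X _) s₁) (2 * p) Z),
    hpI, h𝒪, ha, ?_, ?_, ?_, fun q hq ↦ ?_⟩
  · exact (mem_algebraicClasses_map_iff_of_iso (sliceFiberIso X s₁)).2 (hZ s₁).1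
  · exact map_mem_divisorClassesSpan hX (hf.isSmoothProjective s₁) (sliceFiberIso X s₁).hom (hZ s₁).2
  · rw [hκV p hpI, hV, map_add, map_smul, hres s₁, Iso.symm_hom, map_add, map_smul,
      (sliceFiberIso X s₁).complexBetti_map_inv_map_hom]
  · rw [hκV q hq]
    exact hVH q hq s₁

/-- **The same for anchors that are polarised abelian `n`-folds** (`θ` a polarisation class: rational, supported on a divisor — hence of type
`(1,1)` —, hard Lefschetz), the hypotheses on `(X, θ)` being read off the anchor predicate. [cite: Bloch1972Semiregularity, Remark (7.5)]
[cite: vanGeemen1994HodgeAV, §2.4 and Thm. 4.11] [cite: Andre1996Motifs, §1.1 (p. 10)] -/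
theorem exists_designModLefschetz_at_polarisedAnchor_of_under_hasServedFibre
    (h : LefAtExceptionalRegimeAtUnder 𝒪 n p (HasServedFibre n p 𝔄 𝔖))
    (htr : ∀ ⦃X X' : SchemeOver ℂ⦄ (e : X ≅ X') (θ : complexBetti X 2) (w : complexBetti X (2 * p)), 𝔄 X θ → w ∈ 𝔖 X θ →
      𝔄 X' (complexBetti.map e.inv 2 θ) ∧ complexBetti.map e.inv (2 * p) w ∈ 𝔖 X' (complexBetti.map e.inv 2 θ))
    (h𝔄 : ∀ (X : SchemeOver ℂ) (θ : complexBetti X 2), 𝔄 X θ →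
      (∃ A : AbelianVariety ℂ, A.dim = n ∧ Nonempty (A.X ≅ X)) ∧ IsPolarizationClass n X θ)
    (X : SchemeOver ℂ) (θ : complexBetti X 2) (hanc : 𝔄 X θ)
    (w : complexBetti X (2 * p)) (hw𝔖 : w ∈ 𝔖 X θ) (hwQ : IsRationalClass w) (hwalg : w ∈ algebraicClasses X p)
    (hwD : w ∉ divisorClassesSpan X n p) :
    ∃ (X' : SchemeOver ℂ) (e : X' ≅ X) (I : Finset ℕ) (κ : (q : ℕ) → complexBetti X' (2 * q)) (a : ℂ) (z : complexBetti X (2 * p)),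
      p ∈ I ∧ 𝒪 n X' I κ ∧ a ≠ 0 ∧ z ∈ algebraicClasses X p ∧ z ∈ divisorClassesSpan X n p ∧
      κ p = complexBetti.map e.hom (2 * p) (a • w + z) ∧ ∀ q ∈ I, IsOfHodgeType n X' (2 * q) q q (κ q) := by
  obtain ⟨hXab, hθ⟩ := h𝔄 X θ hanc
  obtain ⟨A, hA, ⟨eA⟩⟩ := hXab
  have hAX : IsSmoothProjective n A.X := hA ▸ AbelianVariety.isSmoothProjective_holds (A := A)
  have hX : IsSmoothProjective n X := hAX.of_iso eA
  exact exists_designModLefschetz_at_anchor_of_under_hasServedFibre h htr X ⟨A, hA, ⟨eA⟩⟩ θ hθ.isRationalClass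
    (isOfHodgeType_of_mem_algebraicClasses_of_isSmoothProjective hX 1 hθ.mem_algebraicClasses) hanc w hw𝔖 hwQ hwalg hwD


/-! ## §2 Non-vacuity: one anchor with a served algebraic non-Lefschetz class gives a served pencil inside the cell's binders -/

/-- **NON-VACUITY OF THE PARTITION VARIABLE INSIDE THE CELL'S BINDERS** (anchor-generic, fact-free). If the anchor data is transportable along
isomorphisms and ONE anchor `(X, θ)` — `X ≅` an abelian `n`-fold, `θ` rational of type `(1,1)` — carries a served rational ALGEBRAIC class
`w ∉ Dᵖ(X) ⊗ ℂ`, then there is a one-parameter abelian scheme `f : 𝒳 ⟶ S` satisfying EVERY binder of the cell `(n, p)` (smooth projective of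
relative dimension `n`, quasi-projective total space, smooth irreducible affine one-dimensional base, abelian fibres, a section), a global class
`W` satisfying the regime-2 hypotheses (fibrewise rational `(p,p)`, algebraic at `s₀`, NOT algebraic-Lefschetz everywhere) AND a served fibre:
the constant pencil `X × 𝔸¹ ⟶ 𝔸¹`, `W := pr₁^*w`, served at the origin by `Θ := pr₁^*θ`. Hence for such anchor data neither piece of the
partition is vacuous BY ITS HYPOTHESIS. [cite: Hartshorne1977, II.3 (p. 89) and II Ex. 4.9] [cite: vanGeemen1994HodgeAV, §2.4 and Thm. 4.11]
[cite: Bloch1972Semiregularity, Remark (7.5)] -/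
theorem exists_servedPencil_of_anchor
    (htr : ∀ ⦃X X' : SchemeOver ℂ⦄ (e : X ≅ X') (θ : complexBetti X 2) (w : complexBetti X (2 * p)), 𝔄 X θ → w ∈ 𝔖 X θ →
      𝔄 X' (complexBetti.map e.inv 2 θ) ∧ complexBetti.map e.inv (2 * p) w ∈ 𝔖 X' (complexBetti.map e.inv 2 θ))
    (X : SchemeOver ℂ) (hXab : ∃ A : AbelianVariety ℂ, A.dim = n ∧ Nonempty (A.X ≅ X))
    (θ : complexBetti X 2) (hθQ : IsRationalClass θ) (hθH : IsOfHodgeType n X 2 1 1 θ) (hanc : 𝔄 X θ)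
    (w : complexBetti X (2 * p)) (hw𝔖 : w ∈ 𝔖 X θ) (hwQ : IsRationalClass w) (hwalg : w ∈ algebraicClasses X p)
    (hwD : w ∉ divisorClassesSpan X n p) :
    ∃ (𝒳 S : SchemeOver ℂ) (f : 𝒳 ⟶ S) (W : complexBetti 𝒳 (2 * p)) (s₀ : ComplexPoints S),
      IsSmoothProjectiveFamily f n ∧ IsQuasiProjectiveOver 𝒳 ∧ IrreducibleSpace S.left ∧ IsAffine S.left ∧
      AlgebraicGeometry.Smooth S.hom ∧ topologicalKrullDim S.left = 1 ∧
      (∀ s : ComplexPoints S, ∃ A' : AbelianVariety ℂ, A'.dim = n ∧ Nonempty (A'.X ≅ fiberOver f s)) ∧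
      (∃ e : S ⟶ 𝒳, e ≫ f = 𝟙 S) ∧
      (∀ s : ComplexPoints S, IsRationalClass (complexBetti.map (fiberι f s) (2 * p) W) ∧
        IsOfHodgeType n (fiberOver f s) (2 * p) p p (complexBetti.map (fiberι f s) (2 * p) W)) ∧
      complexBetti.map (fiberι f s₀) (2 * p) W ∈ algebraicClasses (fiberOver f s₀) p ∧
      (¬ ∀ s : ComplexPoints S,
        complexBetti.map (fiberι f s) (2 * p) W ∈ algebraicClasses (fiberOver f s) p ∧
        complexBetti.map (fiberι f s) (2 * p) W ∈ divisorClassesSpan (fiberOver f s) n p) ∧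
      HasServedFibre n p 𝔄 𝔖 f W := by
  obtain ⟨A, hA, ⟨eA⟩⟩ := hXab
  have hAX : IsSmoothProjective n A.X := hA ▸ AbelianVariety.isSmoothProjective_holds (A := A)
  have hX : IsSmoothProjective n X := hAX.of_iso eA
  have hwH : IsOfHodgeType n X (2 * p) p p w := isOfHodgeType_of_mem_algebraicClasses_of_isSmoothProjective hX p hwalg
  haveI : IrreducibleSpace (specOver ℂ (MvPolynomial (Fin 1) ℂ)).left := irreducibleSpace_affineLine_left
  haveI : IsAffine (specOver ℂ (MvPolynomial (Fin 1) ℂ)).left := isAffine_affineLine_left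
  obtain ⟨s₀⟩ := nonempty_complexPoints_affineLine
  have hf : IsSmoothProjectiveFamily (snd X (specOver ℂ (MvPolynomial (Fin 1) ℂ))) n :=
    isSmoothProjectiveFamily_snd hX _
  have h𝒳 : IsQuasiProjectiveOver (X ⊗ specOver ℂ (MvPolynomial (Fin 1) ℂ)) :=
    isQuasiProjectiveOver_tensor_of_isProjectiveOver hX.isProjectiveOver isQuasiProjectiveOver_affineLine
  have habel : ∀ s : ComplexPoints (specOver ℂ (MvPolynomial (Fin 1) ℂ)),
      ∃ A' : AbelianVariety ℂ, A'.dim = n ∧ Nonempty (A'.X ≅ fiberOver (snd X (specOver ℂ (MvPolynomial (Fin 1) ℂ))) s) :=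
    fun s ↦ ⟨A, hA, ⟨eA ≪≫ sliceFiberIso X s⟩⟩
  have hres := fun s : ComplexPoints (specOver ℂ (MvPolynomial (Fin 1) ℂ)) ↦ map_fiberι_map_fst_eq s (2 * p) w
  have hresθ := fun s : ComplexPoints (specOver ℂ (MvPolynomial (Fin 1) ℂ)) ↦ map_fiberι_map_fst_eq s 2 θ
  have hW : ∀ s : ComplexPoints (specOver ℂ (MvPolynomial (Fin 1) ℂ)),
      IsRationalClass (complexBetti.map (fiberι (snd X _) s) (2 * p) (complexBetti.map (fst X _) (2 * p) w)) ∧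
        IsOfHodgeType n (fiberOver (snd X _) s) (2 * p) p p
          (complexBetti.map (fiberι (snd X _) s) (2 * p) (complexBetti.map (fst X _) (2 * p) w)) := by
    intro s
    rw [hres s]
    exact ⟨(isRationalClass_map_iff_of_iso (sliceFiberIso X s).symm).2 hwQ,
      (isOfHodgeType_map_iff_of_iso (sliceFiberIso X s).symm).2 hwH⟩
  have hWs₀ : complexBetti.map (fiberι (snd X _) s₀) (2 * p) (complexBetti.map (fst X _) (2 * p) w) ∈
      algebraicClasses (fiberOver (snd X (specOver ℂ (MvPolynomial (Fin 1) ℂ))) s₀) p := by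
    rw [hres s₀]
    exact (mem_algebraicClasses_map_iff_of_iso (sliceFiberIso X s₀).symm).2 hwalg
  have hexc : ¬ ∀ s : ComplexPoints (specOver ℂ (MvPolynomial (Fin 1) ℂ)),
      complexBetti.map (fiberι (snd X _) s) (2 * p) (complexBetti.map (fst X _) (2 * p) w) ∈
          algebraicClasses (fiberOver (snd X _) s) p ∧
        complexBetti.map (fiberι (snd X _) s) (2 * p) (complexBetti.map (fst X _) (2 * p) w) ∈
          divisorClassesSpan (fiberOver (snd X _) s) n p := by
    intro hall
    obtain ⟨-, hD⟩ := hall s₀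
    apply hwD
    have hback := map_mem_divisorClassesSpan hX (hf.isSmoothProjective s₀) (sliceFiberIso X s₀).hom hD
    rwa [hres s₀, (sliceFiberIso X s₀).complexBetti_map_hom_map_inv] at hback
  have hserved : HasServedFibre n p 𝔄 𝔖 (snd X (specOver ℂ (MvPolynomial (Fin 1) ℂ))) (complexBetti.map (fst X _) (2 * p) w) := by
    refine ⟨s₀, complexBetti.map (fst X _) 2 θ, fun s ↦ ?_, fun s ↦ ?_, ?_, ?_⟩
    · rw [hresθ s]
      exact (isRationalClass_map_iff_of_iso (sliceFiberIso X s).symm).2 hθQ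
    · rw [hresθ s]
      exact (isOfHodgeType_map_iff_of_iso (sliceFiberIso X s).symm).2 hθH
    · rw [hresθ s₀]
      exact (htr (sliceFiberIso X s₀) θ w hanc hw𝔖).1
    · rw [hresθ s₀, hres s₀]
      exact (htr (sliceFiberIso X s₀) θ w hanc hw𝔖).2
  exact ⟨_, _, snd X (specOver ℂ (MvPolynomial (Fin 1) ℂ)), complexBetti.map (fst X _) (2 * p) w, s₀, hf, h𝒳,
    irreducibleSpace_affineLine_left, isAffine_affineLine_left, smooth_affineLine_hom, topologicalKrullDim_affineLine_left,
    habel, exists_section_snd A eA _, hW, hWs₀, hexc, hserved⟩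

/-- **Hence: with ONE such anchor the through-anchor piece is NOT vacuous by hypothesis** — it genuinely asserts a datum for some pencil of the
cell's shape in regime 2 (which the anchored carrier statement then supplies, `under_hasServedFibre_of_anchoredCarrierAt`), and the residual
EXCLUDES that pencil. Stated as: the served-pencil predicate is satisfiable together with the cell's hypotheses. [cite: Bloch1972Semiregularity, Remark (7.5)]
[cite: Hartshorne1977, II.3 (p. 89)] -/
theorem not_forall_not_hasServedFibre_of_anchor
    (htr : ∀ ⦃X X' : SchemeOver ℂ⦄ (e : X ≅ X') (θ : complexBetti X 2) (w : complexBetti X (2 * p)), 𝔄 X θ → w ∈ 𝔖 X θ →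
      𝔄 X' (complexBetti.map e.inv 2 θ) ∧ complexBetti.map e.inv (2 * p) w ∈ 𝔖 X' (complexBetti.map e.inv 2 θ))
    (X : SchemeOver ℂ) (hXab : ∃ A : AbelianVariety ℂ, A.dim = n ∧ Nonempty (A.X ≅ X))
    (θ : complexBetti X 2) (hθQ : IsRationalClass θ) (hθH : IsOfHodgeType n X 2 1 1 θ) (hanc : 𝔄 X θ)
    (w : complexBetti X (2 * p)) (hw𝔖 : w ∈ 𝔖 X θ) (hwQ : IsRationalClass w) (hwalg : w ∈ algebraicClasses X p)
    (hwD : w ∉ divisorClassesSpan X n p) :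
    ¬ ∀ ⦃𝒳 S : SchemeOver ℂ⦄ (f : 𝒳 ⟶ S) (W : complexBetti 𝒳 (2 * p)), IsSmoothProjectiveFamily f n →
      (∀ s : ComplexPoints S, ∃ A' : AbelianVariety ℂ, A'.dim = n ∧ Nonempty (A'.X ≅ fiberOver f s)) →
      (¬ ∀ s : ComplexPoints S,
        complexBetti.map (fiberι f s) (2 * p) W ∈ algebraicClasses (fiberOver f s) p ∧
        complexBetti.map (fiberι f s) (2 * p) W ∈ divisorClassesSpan (fiberOver f s) n p) →
      ¬ HasServedFibre n p 𝔄 𝔖 f W := by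
  intro hnone
  obtain ⟨𝒳, S, f, W, s₀, hf, -, -, -, -, -, hab, -, -, -, hexc, hserved⟩ :=
    exists_servedPencil_of_anchor htr X hXab θ hθQ hθH hanc w hw𝔖 hwQ hwalg hwD
  exact hnone f W hf hab hexc hserved

end Summit.HodgeConjecture.HodgeConjecture.Ring2.SemiregularRepresentatives

end
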